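import Mathlib.Algebra.CharP.Lemmas
import Mathlib.LinearAlgebra.Matrix.CharP
import Mathlib.GroupTheory.OrderOfElement
import Literature.InformationTheory.QuantumCodes.AbelianTwoBlockParameters
import HarnessLib

/-!
# Two-block codes over `2`-groups with an odd-weight block are trivial (`k = 0`) — the census pruning
# lemma for the cells `n = 2^{r+1}` (venture QEC, PARTITION v2.1 D3.4)

HONEST FRAMING: a PROVED structural lemma (tier KERNEL, axioms standard), no certificate, no distance.
Statement (proposed by the cell's search seat qec-search-8, STATUS 2026-08-26T17:22:06Z, after observing
that every `2`-group cell of the abelian two-block census is empty at weight `3+3`): let `G` be a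
finite abelian group with `|G| = 2^r` and `A = circulant a`, `B = circulant b` the blocks of the
two-block CSS code `H_X = [A|B]`, `H_Z = [Bᵀ|Aᵀ]` over `𝔽₂`. Then
`(circulant a)^{|G|} = (Σ_g a_g) • 1` (`circulant_pow_card_eq_smul_one` — commuting Frobenius:
`(Σ_g a_g P_g)^{2^r} = Σ_g a_g P_{2^r • g} = (Σ_g a_g) P_0` for the translation permutation matrices
`P_g = circulant (Pi.single g 1)`; in words, `𝔽₂[G]` is a local ring), so a block of ODD weight
(`Σ a_g = 1`) is invertible, `ker A = ⊥`, and by `k = 2 · dim (ker A ⊓ ker B)`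
(`AbelianTwoBlock.css_k_eq`, Literature) the code has `k = 0`: `css_k_eq_zero_of_card_eq_two_pow`.
BB corollary `bb_k_eq_zero_of_two_pow`: `ℓ m = 2^r` and `A` or `B` of odd weight (e.g. every
weight-`(3,3)` BB code with `ℓ, m` powers of two) ⇒ `k = 0`. Consequence for the census
(plan/CENSUS-PREREG.md P3.4): such cells are EMPTY BY LEMMA, coverage sentence "empty (lemma
`Summit.Ventures.QEC.AbelianTwoBlock.css_k_eq_zero_of_card_eq_two_pow`)".
-/

namespace Summit.Ventures.QEC

open Matrix Literature.InformationTheory.QuantumCodes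
open Literature.InformationTheory.QuantumCodes.AbelianTwoBlock

namespace AbelianTwoBlock

variable {G : Type*} [Fintype G] [AddCommGroup G] [DecidableEq G]

/-- A `G`-circulant matrix is the combination `Σ_g v_g • P_g` of the translation permutation matrices
`P_g = circulant (Pi.single g 1)`. [folklore] -/
theorem circulant_eq_sum_smul_single {R : Type*} [CommSemiring R] (v : G → R) :
    circulant v = ∑ g, v g • circulant (Pi.single g (1 : R)) := by
  ext i j
  simp only [circulant_apply, Matrix.sum_apply, Matrix.smul_apply, Pi.single_apply, smul_eq_mul,
    mul_ite, mul_one, mul_zero]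
  rw [Finset.sum_ite_eq Finset.univ (i - j) v]
  simp

/-- `P_g · P_h = P_{g+h}` for the translation permutation matrices `P_g = circulant (Pi.single g 1)`.
[folklore] -/
theorem circulant_single_mul_circulant_single {R : Type*} [CommSemiring R] (g h : G) :
    circulant (Pi.single g (1 : R)) * circulant (Pi.single h (1 : R)) =
      circulant (Pi.single (g + h) (1 : R)) := by
  rw [circulant_mul]
  congr 1
  funext i
  simp only [mulVec, dotProduct, circulant_apply, Pi.single_apply, mul_ite, mul_one, mul_zero]
  rw [Finset.sum_ite_eq' Finset.univ h]
  simp [sub_eq_iff_eq_add]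

/-- `P_g ^ k = P_{k • g}`. [folklore] -/
theorem circulant_single_pow {R : Type*} [CommSemiring R] (g : G) (k : ℕ) :
    circulant (Pi.single g (1 : R)) ^ k = circulant (Pi.single (k • g) (1 : R)) := by
  induction k with
  | zero => simp
  | succ k ih => rw [pow_succ, ih, circulant_single_mul_circulant_single, succ_nsmul]

/-- Commuting Frobenius for a finite sum: in characteristic `p`, if the summands pairwise commute then
`(Σ_i f i)^(p^n) = Σ_i (f i)^(p^n)`. [folklore] -/
theorem sum_pow_char_pow_of_commute {R ι : Type*} [Semiring R] (p n : ℕ) [Fact p.Prime] [CharP R p]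
    (s : Finset ι) (f : ι → R) (hc : ∀ i ∈ s, ∀ j ∈ s, Commute (f i) (f j)) :
    (∑ i ∈ s, f i) ^ p ^ n = ∑ i ∈ s, f i ^ p ^ n := by
  classical
  induction s using Finset.induction_on with
  | empty => simp [zero_pow (pow_ne_zero n (Fact.out : p.Prime).ne_zero)]
  | insert i s hi ih =>
    rw [Finset.sum_insert hi, Finset.sum_insert hi,
      add_pow_char_pow_of_commute p n (Commute.sum_right _ _ _ fun j hj =>
        hc i (Finset.mem_insert_self i s) j (Finset.mem_insert_of_mem hj)),
      ih fun i' hi' j' hj' => hc i' (Finset.mem_insert_of_mem hi') j' (Finset.mem_insert_of_mem hj')]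

/-- Over `𝔽₂` and a `2`-group `G` (`|G| = 2^r`): `(circulant a)^{|G|} = (Σ_g a_g) • 1` — by commuting
Frobenius, `(Σ a_g P_g)^{2^r} = Σ a_g P_{2^r • g} = Σ a_g P_0`. (So `𝔽₂[G]` is local: an element of
augmentation `1` is a unit, one of augmentation `0` is nilpotent.) [folklore] -/
theorem circulant_pow_card_eq_smul_one (a : G → ZMod 2) {r : ℕ} (hG : Fintype.card G = 2 ^ r) :
    circulant a ^ Fintype.card G = (∑ g, a g) • (1 : Matrix G G (ZMod 2)) := by
  haveI : Nonempty G := ⟨0⟩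
  have hne : 2 ^ r ≠ 0 := pow_ne_zero r (by norm_num)
  have h01 : ∀ c : ZMod 2, c = 0 ∨ c = 1 := by decide
  have hc : ∀ c : ZMod 2, c ^ 2 ^ r = c := by
    intro c
    rcases h01 c with rfl | rfl
    · exact zero_pow hne
    · exact one_pow _
  rw [circulant_eq_sum_smul_single a, hG, sum_pow_char_pow_of_commute 2 r]
  · rw [Finset.sum_smul]
    refine Finset.sum_congr rfl fun g _ => ?_
    rw [smul_pow, circulant_single_pow, hc, ← hG, card_nsmul_eq_zero, circulant_single_one]
  · intro i _ j _
    rw [← circulant_smul, ← circulant_smul]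
    exact circulant_mul_comm _ _

/-- Over a `2`-group, a circulant block of ODD weight (`Σ_g a_g = 1` in `𝔽₂`) has trivial kernel.
[folklore] -/
theorem ker_circulant_eq_bot_of_sum_eq_one (a : G → ZMod 2) {r : ℕ} (hG : Fintype.card G = 2 ^ r)
    (ha : ∑ g, a g = 1) : LinearMap.ker (circulant a).mulVecLin = ⊥ := by
  refine (Submodule.eq_bot_iff _).2 fun v hv => ?_
  have hv' : circulant a *ᵥ v = 0 := hv
  have hpow := circulant_pow_card_eq_smul_one a hG
  rw [ha, one_smul] at hpow
  have hpos : 0 < Fintype.card G := Fintype.card_pos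
  obtain ⟨k, hk⟩ : ∃ k, Fintype.card G = k + 1 := ⟨Fintype.card G - 1, by omega⟩
  rw [hk, pow_succ] at hpow
  calc v = (1 : Matrix G G (ZMod 2)) *ᵥ v := by rw [one_mulVec]
    _ = (circulant a ^ k * circulant a) *ᵥ v := by rw [hpow]
    _ = 0 := by rw [← mulVec_mulVec, hv', mulVec_zero]

omit [AddCommGroup G] [DecidableEq G] in
/-- The weight parity of a binary vector: `Σ_g a_g = |a| (mod 2)`. [folklore] -/
theorem sum_eq_hammingNorm_cast (a : G → ZMod 2) : ∑ g, a g = (hammingNorm a : ZMod 2) := by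
  have key : ∀ c : ZMod 2, c = if c ≠ 0 then 1 else 0 := by decide
  unfold hammingNorm
  rw [← Finset.sum_boole]
  exact Finset.sum_congr rfl fun g _ => key (a g)

omit [AddCommGroup G] [DecidableEq G] in
/-- Odd Hamming weight means `Σ_g a_g = 1` in `𝔽₂`. [folklore] -/
theorem sum_eq_one_of_odd (a : G → ZMod 2) (ha : Odd (hammingNorm a)) : ∑ g, a g = 1 := by
  rw [sum_eq_hammingNorm_cast, ZMod.natCast_eq_one_iff_odd.2 ha]

/-- **Two-block codes over `2`-groups with an odd-weight block are trivial**: if `|G| = 2^r` and the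
block `A = circulant a` or the block `B = circulant b` has odd row weight, then `k = 0` (no logical
qubit) — since `k = 2·dim(ker A ⊓ ker B)` and the odd-weight block has `ker = ⊥`. Consequence for the
qec census: every cell `n = 2|G| = 2^{r+1}` with weight-`(3,3)` (indeed any odd-weight) blocks is EMPTY a
priori. Proved. [folklore] -/
theorem css_k_eq_zero_of_card_eq_two_pow (a b : G → ZMod 2) {r : ℕ} (hG : Fintype.card G = 2 ^ r)
    (hodd : Odd (hammingNorm a) ∨ Odd (hammingNorm b)) : (css a b).k = 0 := by
  rw [css_k_eq]
  rcases hodd with ha | hb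
  · rw [ker_circulant_eq_bot_of_sum_eq_one a hG (sum_eq_one_of_odd a ha), bot_inf_eq, finrank_bot,
      mul_zero]
  · rw [ker_circulant_eq_bot_of_sum_eq_one b hG (sum_eq_one_of_odd b hb), inf_bot_eq, finrank_bot,
      mul_zero]

end AbelianTwoBlock

/-! ### BB corollaries (`G = ℤ_ℓ × ℤ_m`) -/

namespace BB

open Literature.InformationTheory.QuantumCodes.BB

variable {ℓ m : ℕ}

/-- The weight of the coefficient vector `g ↦ p(−g)` is the weight of `p` (number of monomials).
[cite: BravyiEtAl2024, §4 (arXiv:2308.07915 chunk p0009 L24: "A and B have exactly three non-zero entries in each row and each column")] -/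
theorem hammingNorm_coeffVec (p : BB.Poly ℓ m) :
    hammingNorm (coeffVec p) = hammingNorm p := by
  have : coeffVec p = p ∘ (Equiv.neg (BB.Mono ℓ m)) := by
    funext g; simp [coeffVec]
  rw [this]
  exact hammingNorm_comp_equiv p (Equiv.neg _)

variable [NeZero ℓ] [NeZero m] (C : BB.Code ℓ m)

/-- **BB codes with `ℓm` a power of two and an odd-weight `A` or `B` are trivial** (`k = 0`): e.g.
every weight-`(3,3)` BB code with `ℓ, m` powers of two. Proved (`2`-group lemma).
[cite: BravyiEtAl2024, Lemma 1 "k = 2 · dim(ker A ∩ ker B)" (arXiv:2308.07915 chunk p0009 L72)] -/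
theorem bb_k_eq_zero_of_two_pow {r : ℕ} (hℓm : ℓ * m = 2 ^ r)
    (hodd : Odd (hammingNorm C.A) ∨ Odd (hammingNorm C.B)) : C.k = 0 := by
  have hG : Fintype.card (BB.Mono ℓ m) = 2 ^ r := by
    rw [Fintype.card_prod, Fintype.card_fin, Fintype.card_fin, hℓm]
  rw [← hammingNorm_coeffVec C.A, ← hammingNorm_coeffVec C.B] at hodd
  exact AbelianTwoBlock.css_k_eq_zero_of_card_eq_two_pow _ _ hG hodd

/-- Instance (sanity check of the hypotheses' decidability): the weight-`(3,3)` two-block code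
`QC(x + y + y², y + x + x²)` on `ℤ₄ × ℤ₄` (`n = 32`) encodes no qubit. (proved: `16 = 2^4`, weight `3`
is odd by `decide`.) -/
theorem bb_4_4_example_k_eq_zero :
    (⟨xPow 1 + yPow 1 + yPow 2, yPow 1 + xPow 1 + xPow 2⟩ : BB.Code 4 4).k = 0 :=
  bb_k_eq_zero_of_two_pow _ (r := 4) (by norm_num) (Or.inl (by decide))

end BB

end Summit.Ventures.QEC

/-! ### Census-cell form: the printed BB shape (`IsBBPoly`: three distinct monomials) already forces odd
weight, so every weight-`(3,3)` cell with `ℓm = 2^r` is empty — no weight computation needed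
(appended 2026-08-26; the `IsBBPoly ⇒ Σ = 1` step follows qec-lit-1's unfiled draft
`HOME/lean/lit-1/AbelianTwoBlockTwoGroups.lean`, with thanks). -/

namespace Summit.Ventures.QEC.BB

open Literature.InformationTheory.QuantumCodes Literature.InformationTheory.QuantumCodes.BB

variable {ℓ m : ℕ} [NeZero ℓ] [NeZero m]

omit [NeZero ℓ] [NeZero m] in
/-- A monomial has coefficient sum `1`. -/
theorem sum_monomial (a : Fin ℓ) (b : Fin m) : ∑ g, BB.monomial a b g = 1 := by
  simp [BB.monomial]

/-- A polynomial of the printed BB shape (three distinct monomials) has coefficient sum `1 + 1 + 1 = 1`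
in `𝔽₂` (augmentation one). -/
theorem sum_eq_one_of_isBBPoly {p : BB.Poly ℓ m} (hp : BB.IsBBPoly p) : ∑ g, p g = 1 := by
  obtain ⟨g₁, g₂, g₃, -, -, -, -, rfl⟩ := hp
  simp only [Pi.add_apply, Finset.sum_add_distrib, sum_monomial]
  decide

/-- Hence a polynomial of the printed BB shape has ODD weight. -/
theorem odd_hammingNorm_of_isBBPoly {p : BB.Poly ℓ m} (hp : BB.IsBBPoly p) : Odd (hammingNorm p) :=
  ZMod.natCast_eq_one_iff_odd.1
    ((AbelianTwoBlock.sum_eq_hammingNorm_cast p).symm.trans (sum_eq_one_of_isBBPoly hp))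

/-- **Census-cell form of the pruning lemma**: a bivariate-bicycle code `QC(A, B)` with `ℓm = 2^r`
whose `A` or `B` has the printed shape `A₁ + A₂ + A₃` (three distinct powers of `x` or `y`) encodes no
qubit (`k = 0`). So the cells `n = 2ℓm ∈ {16, 32, 64, 128, 256, 512}` of the weight-`(3,3)` BB census are
EMPTY BY LEMMA. (proved) -/
theorem bb_k_eq_zero_of_isBBPoly (C : BB.Code ℓ m) {r : ℕ} (hℓm : ℓ * m = 2 ^ r)
    (hAB : BB.IsBBPoly C.A ∨ BB.IsBBPoly C.B) : C.k = 0 :=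
  bb_k_eq_zero_of_two_pow C hℓm (hAB.imp odd_hammingNorm_of_isBBPoly odd_hammingNorm_of_isBBPoly)

end Summit.Ventures.QEC.BB

/-! ## Even-weight blocks force `k ≥ 2` (census cells with `w = 4+4`, `2+4`, …; qec-type-05 gen 2)

If BOTH blocks have even row weight, the all-ones vector lies in `ker A ⊓ ker B` (every row of a
`G`-circulant matrix has the same weight `|a|`), so `k = 2·dim(ker A ⊓ ker B) ≥ 2`: an abelian two-block
code with even-weight blocks is never trivial (the qec census observed «every w = 4+4 code has k ≥ 2»
empirically, search-8 2026-08-26; this is the reason). Dual to the `2`-group pruning lemma above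
(odd weight over a `2`-group ⇒ `k = 0`).
-/

namespace Summit.Ventures.QEC.AbelianTwoBlock

open Matrix Literature.InformationTheory.QuantumCodes Literature.InformationTheory.QuantumCodes.AbelianTwoBlock

variable {G : Type*} [Fintype G] [AddCommGroup G] [DecidableEq G]

omit [DecidableEq G] in
/-- A `G`-circulant block of even row weight annihilates the all-ones vector: `A·𝟙 = |a|·𝟙 = 0` over `𝔽₂`.
[folklore] -/
theorem circulant_mulVec_one_eq_zero_of_even (a : G → ZMod 2) (ha : Even (hammingNorm a)) :
    circulant a *ᵥ (fun _ => 1) = 0 := by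
  funext g
  simp only [mulVec, dotProduct, circulant_apply, mul_one, Pi.zero_apply]
  rw [show ∑ h, a (g - h) = ∑ h, a h from
    Fintype.sum_equiv (Equiv.subLeft g) (fun h => a (g - h)) a (fun h => rfl),
    sum_eq_hammingNorm_cast, ZMod.natCast_eq_zero_iff_even]
  exact ha

/-- **Even-weight blocks ⇒ `k ≥ 2`**: if `|a|` and `|b|` are both even (and `G` is nonempty) then the
two-block code `css a b` encodes at least two qubits (`𝟙 ∈ ker A ⊓ ker B` and `k = 2·dim(ker A ⊓ ker B)`).
Census consequence: no `(n,k=0)` class exists in any even+even weight cell. Proved. [folklore] -/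
theorem two_le_css_k_of_even [Nonempty G] (a b : G → ZMod 2) (ha : Even (hammingNorm a))
    (hb : Even (hammingNorm b)) : 2 ≤ (css a b).k := by
  rw [css_k_eq]
  set K := LinearMap.ker (circulant a).mulVecLin ⊓ LinearMap.ker (circulant b).mulVecLin with hK
  have h1 : (fun _ : G => (1 : ZMod 2)) ∈ K := by
    simp only [hK, Submodule.mem_inf, LinearMap.mem_ker, Matrix.mulVecLin_apply]
    exact ⟨circulant_mulVec_one_eq_zero_of_even a ha, circulant_mulVec_one_eq_zero_of_even b hb⟩
  have hne : (fun _ : G => (1 : ZMod 2)) ≠ 0 := by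
    intro h
    have := congr_fun h (Classical.arbitrary G)
    simp at this
  have hle : Module.finrank (ZMod 2) (Submodule.span (ZMod 2) {fun _ : G => (1 : ZMod 2)}) ≤
      Module.finrank (ZMod 2) K :=
    Submodule.finrank_mono (Submodule.span_le.2 (Set.singleton_subset_iff.2 h1))
  rw [finrank_span_singleton hne] at hle
  omega

end Summit.Ventures.QEC.AbelianTwoBlock

namespace Summit.Ventures.QEC.BB

open Literature.InformationTheory.QuantumCodes Literature.InformationTheory.QuantumCodes.BB

variable {ℓ m : ℕ} [NeZero ℓ] [NeZero m]

/-- **BB codes with even-weight `A` and `B` have `k ≥ 2`** (e.g. every weight-`(4,4)` or `(2,4)` cell of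
the census). Proved. [cite: BravyiEtAl2024, Lemma 1 "k = 2 · dim(ker A ∩ ker B)" (arXiv:2308.07915 chunk p0009 L72)] -/
theorem bb_two_le_k_of_even (C : BB.Code ℓ m) (hA : Even (hammingNorm C.A)) (hB : Even (hammingNorm C.B)) :
    2 ≤ C.k := by
  rw [← hammingNorm_coeffVec C.A] at hA
  rw [← hammingNorm_coeffVec C.B] at hB
  exact AbelianTwoBlock.two_le_css_k_of_even _ _ hA hB

/-- Instance: the weight-`(4,4)` code `QC(1 + x + y + y², 1 + y + x + x²)` on `ℤ₃ × ℤ₃` (`n = 18`) has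
`k ≥ 2` (weights `4, 4` even by `decide`). -/
theorem bb_3_3_even_example_two_le_k :
    2 ≤ (⟨xPow 0 + xPow 1 + yPow 1 + yPow 2, xPow 0 + yPow 1 + xPow 1 + xPow 2⟩ : BB.Code 3 3).k :=
  bb_two_le_k_of_even _ (by decide) (by decide)

end Summit.Ventures.QEC.BB

/-! ### APPEND 2026-08-27 (qec-type-05 g3): a WEIGHT-ONE block makes the code trivial over ANY finite
abelian group — the «w_A = 1 cells are EMPTY BY LEMMA» clause of plan/CENSUS-PREREG.md P3.15 (cell A.3s):
a single group element `s` is a unit of `𝔽₂[G]` (`P_s · P_{−s} = 1` for the translation permutation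
matrix `P_s = circulant (Pi.single s 1)`), so `ker A = ⊥` and `k = 2·dim(ker A ⊓ ker B) = 0`. -/

namespace Summit.Ventures.QEC.AbelianTwoBlock

open Matrix Literature.InformationTheory.QuantumCodes Literature.InformationTheory.QuantumCodes.AbelianTwoBlock

variable {G : Type*} [Fintype G] [AddCommGroup G] [DecidableEq G]

/-- A translation permutation matrix has trivial kernel: `ker (circulant (Pi.single s 1)) = ⊥`
(`P_{−s} P_s = P_0 = 1`). [folklore] -/
theorem ker_circulant_single_eq_bot (s : G) :
    LinearMap.ker (circulant (Pi.single s (1 : ZMod 2))).mulVecLin = ⊥ := by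
  refine (Submodule.eq_bot_iff _).2 fun v hv => ?_
  have hv' : circulant (Pi.single s (1 : ZMod 2)) *ᵥ v = 0 := hv
  have hinv : circulant (Pi.single (-s) (1 : ZMod 2)) * circulant (Pi.single s (1 : ZMod 2)) = 1 := by
    rw [circulant_single_mul_circulant_single, neg_add_cancel]
    ext i j
    simp [circulant_apply, one_apply, Pi.single_apply, sub_eq_zero]
  calc v = (1 : Matrix G G (ZMod 2)) *ᵥ v := by rw [one_mulVec]
    _ = (circulant (Pi.single (-s) 1) * circulant (Pi.single s 1)) *ᵥ v := by rw [hinv]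
    _ = 0 := by rw [← mulVec_mulVec, hv', mulVec_zero]

omit [AddCommGroup G] in
/-- A weight-one binary vector is an indicator of a single point. [folklore] -/
theorem eq_single_of_hammingNorm_eq_one (a : G → ZMod 2) (ha : hammingNorm a = 1) :
    ∃ s, a = Pi.single s 1 := by
  unfold hammingNorm at ha
  obtain ⟨s, hs⟩ := Finset.card_eq_one.mp ha
  refine ⟨s, funext fun g => ?_⟩
  have key : ∀ c : ZMod 2, c ≠ 0 → c = 1 := by decide
  by_cases hg : g = s
  · subst hg
    have : g ∈ Finset.univ.filter fun i => a i ≠ 0 := by rw [hs]; exact Finset.mem_singleton_self g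
    rw [Finset.mem_filter] at this
    simp [key _ this.2]
  · have : g ∉ Finset.univ.filter fun i => a i ≠ 0 := by rw [hs]; simpa using hg
    rw [Finset.mem_filter] at this
    simp only [Finset.mem_univ, true_and, not_not] at this
    simp [this, hg]

/-- **A weight-ONE block makes a two-block code trivial, over ANY finite abelian group**: if `|a| = 1` or
`|b| = 1` (the block is a single group element `s`, i.e. the permutation matrix `P_s`, a UNIT of
`𝔽₂[G]`), then `k(css a b) = 0`. Census consequence (plan/CENSUS-PREREG.md P3.15, cell A.3s): every
weight split `(1, w_B)` / `(w_A, 1)` cell is EMPTY BY LEMMA, for all abelian `G` (no `2`-group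
hypothesis, unlike `css_k_eq_zero_of_card_eq_two_pow`). Proved. [folklore] -/
theorem css_k_eq_zero_of_hammingNorm_eq_one (a b : G → ZMod 2)
    (h : hammingNorm a = 1 ∨ hammingNorm b = 1) : (css a b).k = 0 := by
  rw [css_k_eq]
  rcases h with ha | hb
  · obtain ⟨s, rfl⟩ := eq_single_of_hammingNorm_eq_one a ha
    rw [ker_circulant_single_eq_bot, bot_inf_eq, finrank_bot, mul_zero]
  · obtain ⟨t, rfl⟩ := eq_single_of_hammingNorm_eq_one b hb
    rw [ker_circulant_single_eq_bot, inf_bot_eq, finrank_bot, mul_zero]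

end Summit.Ventures.QEC.AbelianTwoBlock

namespace Summit.Ventures.QEC.BB

open Literature.InformationTheory.QuantumCodes Literature.InformationTheory.QuantumCodes.BB

variable {ℓ m : ℕ} [NeZero ℓ] [NeZero m]

/-- **BB form**: a bivariate-bicycle / abelian two-block code `QC(A, B)` on `ℤ_ℓ × ℤ_m` in which `A` or
`B` is a single monomial (`|A| = 1` or `|B| = 1`) has `k = 0`, for every `ℓ, m`. Proved. [folklore] -/
theorem bb_k_eq_zero_of_weight_one (C : BB.Code ℓ m) (h : hammingNorm C.A = 1 ∨ hammingNorm C.B = 1) :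
    C.k = 0 := by
  rw [← hammingNorm_coeffVec C.A, ← hammingNorm_coeffVec C.B] at h
  exact AbelianTwoBlock.css_k_eq_zero_of_hammingNorm_eq_one _ _ h

/-- Instance: `QC(x, 1 + x + y)` on `ℤ₃ × ℤ₅` (a weight-`(1,3)` cell, `|G| = 15` not a `2`-power) has
`k = 0`. -/
theorem bb_weight_one_example_k_eq_zero :
    (⟨xPow 1, xPow 0 + xPow 1 + yPow 1⟩ : BB.Code 3 5).k = 0 :=
  bb_k_eq_zero_of_weight_one _ (Or.inl (by decide))

end Summit.Ventures.QEC.BB
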